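import Summits.MatrixMultiplication.OmegaCensus.STPPVosperSlackTwoCheckersT
import Summits.MatrixMultiplication.OmegaCensus.STPPVosperSlackTwoCoverDead
import Summits.MatrixMultiplication.OmegaCensus.STPPVosperSlackTwoCheckersSound2
import Summits.MatrixMultiplication.OmegaCensus.STPPVosperSlackTwoShapes

/-!
# ω-census (abelian STPP census): SOUNDNESS of the table-form slack-2 case-A checker in normal form, any number of blocks (kernel tool)

HONEST FRAMING (pub-omega census; verbatim): lottery ticket; floor = certified bounds/negative ranges.
Census STRUCTURE (seat pub-omega-stpp-1 gen 33, 2026-08-28), family (b2).  `caseADeadT_false_of_normal_form`: an STPP family of `ℤ/p` with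
`N` non-empty blocks in the normal form of the PINNED-INTERVAL gauge of `STPPVosperSlackTwoCheckersT.lean` at block `i` — `A i = [0, a)`,
`Y° = ⋃_{k≠i}(C_k − B_k) = [a − 1, a − 1 + L)` (so `SY = −A i + Y° = [0, a + L − 1)`), `a + L ≤ p` — whose other blocks (in the order `ks`)
have sizes `szs`, together with a table `tbl` all of whose entries are `CoverDead p N i szs` (`STPPVosperSlackTwoCoverDead.lean`), makes
`caseADeadT p a c L z Q tbl` return `false` on the value list `Q` of `B i`: the family passes every stage (pattern packing `add_injOn_AB`; the tiling
`W = ⊔_{γ ∈ C i}(γ − A i − B i)` as an admissible choice of ALL `c` translates from the cover `SY` — `admissible_filter_transMasks_all`, a variant of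
stpp-1 g32's `admissible_filter_transMasks` without a pinned translate; `Z° ⊆` candidates because `T = −B i + Z°` misses `W ∪ SY`
(`disjoint_W_negA_add_DU`, `disjoint_negB_add_DU_AC`); the leaf via `caseALeafT_of_caseADeadT` / `mem_of_caseALeafT`), so the pair `(Yo, Zo)` of the
family is in the table — contradicting its deadness for the family itself.  The pattern of stpp-1 g32's `caseADeadQ'_false_of_normal_form`
(`STPPVosperSlackTwoSoundA.lean`), minus the interval search and the realisation stage.  UNCONDITIONAL; no `decide`.  Nothing here is progress on `ω`.

References: H. Cohn, R. Kleinberg, B. Szegedy, C. Umans, FOCS 2005 (arXiv:math/0511460), Def. 5.1; A. G. Vosper, J. London Math. Soc. 31 (1956).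
-/

open Finset
open scoped Pointwise

namespace Summit.MatrixMultiplication.OmegaCensus.CubeNB.S2

open Literature.Computability.AlgebraicComplexity
open Literature.Combinatorics.Additive
open Summit.MatrixMultiplication.OmegaCensus.STPPKneser
open Summit.MatrixMultiplication.OmegaCensus.CubeNB.Bits

/-! ## §1 The tiling of ALL translates as an admissible choice sequence -/

/-- **The actual tiling as a choice sequence, no pinned translate.**  Given positions `RS ⊆ [0, p)` whose translates `r − patt` avoid the initial cover
`cov₀` and are pairwise disjoint: the sub-sequence of `transMasks` with positions in `RS` is a sublist of length `#RS`, sequentially admissible from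
`cov₀`, with the stated members. [folklore] -/
theorem admissible_filter_transMasks_all (p : ℕ) (patt : List ℕ) (cov₀ : ℕ) (RS : Finset ℕ) (hRS : ∀ r ∈ RS, r < p)
    (hcov : ∀ r ∈ RS, ∀ y ∈ patt, tb cov₀ ((r + p - y) % p) = false)
    (hpair : ∀ r ∈ RS, ∀ r' ∈ RS, r ≠ r' → ∀ y ∈ patt, ∀ y' ∈ patt, (r + p - y) % p ≠ (r' + p - y') % p) :
    ((transMasks p patt).filter fun x => decide (x.1 ∈ RS)).Sublist (transMasks p patt) ∧
    ((transMasks p patt).filter fun x => decide (x.1 ∈ RS)).length = RS.card ∧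
    admissible cov₀ ((transMasks p patt).filter fun x => decide (x.1 ∈ RS)) = true ∧
    (∀ x, x ∈ ((transMasks p patt).filter fun x => decide (x.1 ∈ RS)) ↔
      x.1 ∈ RS ∧ x = (x.1, maskOf (patt.map fun y => (x.1 + p - y) % p))) := by
  set rs := (transMasks p patt).filter fun x => decide (x.1 ∈ RS) with hrs
  have hmem : ∀ x, x ∈ rs ↔ x.1 ∈ RS ∧ x = (x.1, maskOf (patt.map fun y => (x.1 + p - y) % p)) := by
    intro x
    rw [hrs, List.mem_filter, decide_eq_true_eq, mem_transMasks]
    constructor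
    · rintro ⟨⟨r, _, rfl⟩, hx⟩
      exact ⟨hx, rfl⟩
    · rintro ⟨hx, hxe⟩
      exact ⟨⟨x.1, hRS _ hx, hxe⟩, hx⟩
  have hfst : rs.map Prod.fst = (List.range p).filter fun r => decide (r ∈ RS) := by
    rw [hrs, transMasks, List.filter_map, List.map_map]
    have : (Prod.fst ∘ fun r => (r, maskOf (patt.map fun y => (r + p - y) % p))) = id := rfl
    rw [this, List.map_id]
    rfl
  have hnd : (rs.map Prod.fst).Nodup := by
    rw [hfst]; exact (List.nodup_range (n := p)).filter _
  refine ⟨List.filter_sublist, ?_, ?_, hmem⟩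
  · rw [← List.length_map (f := Prod.fst), hfst]
    have hset : ((List.range p).filter fun r => decide (r ∈ RS)).toFinset = RS := by
      ext r
      rw [List.mem_toFinset, List.mem_filter, decide_eq_true_eq, List.mem_range]
      constructor
      · exact fun h => h.2
      · exact fun h => ⟨hRS r h, h⟩
    have hl := List.toFinset_card_of_nodup ((List.nodup_range (n := p)).filter fun r => decide (r ∈ RS))
    rw [hset] at hl
    exact hl.symm
  · refine admissible_of_pairwise rs cov₀ (fun x hx => ?_) ?_
    · obtain ⟨hx1, hxe⟩ := (hmem x).1 hx
      rw [hxe, disjB_eq_true_iff]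
      rintro v ⟨hv1, hv2⟩
      obtain ⟨y, hy, rfl⟩ := (tb_transMask p patt x.1 v).1 hv1
      rw [hcov x.1 hx1 y hy] at hv2
      exact Bool.noConfusion hv2
    · have hpw : rs.Pairwise fun x y => x.1 ≠ y.1 := List.pairwise_map.1 hnd
      refine hpw.imp_of_mem ?_
      intro x x' hx hx' hne
      obtain ⟨hx1, hxe⟩ := (hmem x).1 hx
      obtain ⟨hx1', hxe'⟩ := (hmem x').1 hx'
      rw [hxe, hxe', disjB_eq_true_iff]
      rintro v ⟨hv1, hv2⟩
      obtain ⟨y', hy', rfl⟩ := (tb_transMask p patt x'.1 v).1 hv1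
      obtain ⟨y, hy, hyy⟩ := (tb_transMask p patt x.1 _).1 hv2
      exact hpair x.1 hx1 x'.1 hx1' hne y hy y' hy' hyy

/-! ## §2 Normal-form soundness of `caseADeadT` -/

variable {p : ℕ} [hp : Fact p.Prime]

/-- **NORMAL-FORM SOUNDNESS of the table-form case-A checker.**  For an STPP family of `ℤ/p` with `N` non-empty blocks in normal form at block `i` —
`A i = {0, 1, …, a−1}`, `Y° = ⋃_{k≠i}(C_k − B_k) = {a−1, a, …, a+L−2}` (`L = Σ_{k≠i} |B_k||C_k|`, `z = Σ_{k≠i} |A_k||C_k|`, `a + L ≤ p`) — with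
the other blocks `ks` of sizes `szs`, and a table of pairs all `CoverDead p N i szs`, the checker `caseADeadT` does NOT return `true` on the value list
of `B i`. [cite: CohnKleinbergSzegedyUmans2005, Def. 5.1] -/
theorem caseADeadT_false_of_normal_form {N : ℕ} {A B C : Fin N → Finset (ZMod p)} (hS : IsSTPP A B C)
    (hA : ∀ k, (A k).Nonempty) (hB : ∀ k, (B k).Nonempty) (hC : ∀ k, (C k).Nonempty) (i : Fin N)
    (hI : ((univ : Finset (Fin N)).erase i).Nonempty) {a c L z : ℕ} (ha : #(A i) = a) (hc : #(C i) = c)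
    (hz : ∑ k ∈ univ.erase i, #(A k) * #(C k) = z) (hL : ∑ k ∈ univ.erase i, #(B k) * #(C k) = L) (hap : a + L ≤ p)
    (hA0 : A i = (Finset.range a).image fun k : ℕ => (k : ZMod p))
    (hY : DU B C (univ.erase i) = (Finset.range L).image fun t : ℕ => ((a - 1 : ℕ) : ZMod p) + (t : ZMod p))
    (ks : List (Fin N)) (hks : ks.Nodup) (hksi : ∀ k, k ∈ ks ↔ k ≠ i) {szs : List (ℕ × ℕ × ℕ)}
    (hszs : ks.map (fun k => (#(A k), #(B k), #(C k))) = szs)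
    {tbl : List (List ℕ × List ℕ)} (hdead : ∀ e ∈ tbl, CoverDead p N i szs e.1 e.2) :
    caseADeadT p a c L z (((B i).image ZMod.val).sort (· ≤ ·)) tbl = false := by
  rw [Bool.eq_false_iff]; intro h
  have hp0 : 0 < p := hp.out.pos
  have ha1 : 1 ≤ a := by rw [← ha]; exact (hA i).card_pos
  have hL1 : 1 ≤ L := by rw [← hL, ← card_DU_BC hS hA]; exact (DU_nonempty hI hB hC).card_pos
  set Q := ((B i).image ZMod.val).sort (· ≤ ·) with hQdef
  obtain ⟨hQmem, hQnd, hQlt, -⟩ := valList_spec (B i)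
  have hA0mem : ∀ x : ℕ, x < a → (x : ZMod p) ∈ A i := fun x hx => by rw [hA0]; exact mem_image.2 ⟨x, mem_range.2 hx, rfl⟩
  -- the pattern `P + Q` is duplicate-free (packing of `A i + B i`)
  set patt := pattPQ p (List.range a) Q with hpattdef
  have hpatt_mem : ∀ w, w ∈ patt ↔ ∃ x : ℕ, x < a ∧ ∃ b ∈ B i, (x + b.val) % p = w := by
    intro w; rw [hpattdef, pattPQ, List.mem_flatMap]
    constructor
    · rintro ⟨x, hx, hw⟩
      rw [List.mem_map] at hw
      obtain ⟨q, hq, rfl⟩ := hw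
      obtain ⟨b, hb, rfl⟩ := (hQmem q).1 hq
      exact ⟨x, List.mem_range.1 hx, b, hb, rfl⟩
    · rintro ⟨x, hx, b, hb, rfl⟩
      exact ⟨x, List.mem_range.2 hx, List.mem_map.2 ⟨b.val, (hQmem _).2 ⟨b, hb, rfl⟩, rfl⟩⟩
  have hpatt_cast : ∀ (x : ℕ) (b : ZMod p), ((((x + b.val) % p : ℕ)) : ZMod p) = (x : ZMod p) + b := fun x b => by
    rw [cast_add_mod, ZMod.natCast_zmod_val]
  have hpatt : patt.Nodup := by
    rw [hpattdef, pattPQ, List.nodup_flatMap]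
    constructor
    · intro x _
      refine List.Nodup.map_on (fun q hq q' hq' hqq => ?_) hQnd
      have hq1 := hQlt q hq
      have hq2 := hQlt q' hq'
      have := congrArg (fun n : ℕ => (n : ZMod p)) hqq
      simp only [cast_add_mod, add_right_inj] at this
      have := congrArg ZMod.val this
      rwa [ZMod.val_natCast_of_lt hq1, ZMod.val_natCast_of_lt hq2] at this
    · refine (List.nodup_range (n := a)).imp_of_mem ?_
      intro x x' hx hx' hne v hv hv'
      rw [List.mem_map] at hv hv'
      obtain ⟨q, hq, rfl⟩ := hv
      obtain ⟨q', hq', hqq⟩ := hv'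
      obtain ⟨b, hb, rfl⟩ := (hQmem q).1 hq
      obtain ⟨b', hb', rfl⟩ := (hQmem q').1 hq'
      have hcast := congrArg (fun n : ℕ => (n : ZMod p)) hqq
      simp only [hpatt_cast] at hcast
      have hxlt := List.mem_range.1 hx
      have hxlt' := List.mem_range.1 hx'
      obtain ⟨hxx, -⟩ := add_injOn_AB hS hC i (hA0mem x' hxlt') (hA0mem x hxlt) hb' hb hcast
      have := congrArg ZMod.val hxx
      rw [ZMod.val_natCast_of_lt (by omega), ZMod.val_natCast_of_lt (by omega)] at this
      exact hne this.symm
  -- the three sets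
  set W := ((A i) ×ˢ ((B i) ×ˢ (C i))).image fun q : ZMod p × ZMod p × ZMod p => (0 : ZMod p) + q.2.2 - q.1 - q.2.1 with hW
  set SY := (A i).image (fun x => (0 : ZMod p) - x) + DU B C (univ.erase i) with hSY
  set T := (B i).image (fun x => (0 : ZMod p) - x) + DU A C (univ.erase i) with hT
  have hWSY : Disjoint W SY := disjoint_W_negA_add_DU hS i
  have hTWSY : Disjoint T (W ∪ SY) := disjoint_negB_add_DU_AC hS i
  have hmemW : ∀ x ∈ A i, ∀ b ∈ B i, ∀ cc ∈ C i, cc - x - b ∈ W := fun x hx b hb cc hcc =>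
    mem_image.2 ⟨(x, b, cc), mem_product.2 ⟨hx, mem_product.2 ⟨hb, hcc⟩⟩, by ring⟩
  -- `SY ⊇ [0, a + L − 1)` (in fact `=`)
  have hmemSY : ∀ t, t < a + L - 1 → ((t : ℕ) : ZMod p) ∈ SY := by
    intro t ht
    by_cases hta : t ≤ a - 1
    · have hk : ((a - 1 - t : ℕ) : ZMod p) ∈ A i := hA0mem _ (by omega)
      have hy0 : ((a - 1 : ℕ) : ZMod p) + ((0 : ℕ) : ZMod p) ∈ DU B C (univ.erase i) := by
        rw [hY]; exact mem_image.2 ⟨0, mem_range.2 (by omega), rfl⟩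
      have hneg : (0 : ZMod p) - ((a - 1 - t : ℕ) : ZMod p) ∈ (A i).image (fun x => (0 : ZMod p) - x) := mem_image.2 ⟨_, hk, rfl⟩
      have := Finset.add_mem_add hneg hy0
      convert this using 1
      rw [Nat.cast_sub hta, Nat.cast_zero]; ring
    · have hk : ((0 : ℕ) : ZMod p) ∈ A i := hA0mem 0 (by omega)
      have hy0 : ((a - 1 : ℕ) : ZMod p) + ((t - (a - 1) : ℕ) : ZMod p) ∈ DU B C (univ.erase i) := by
        rw [hY]; exact mem_image.2 ⟨t - (a - 1), mem_range.2 (by omega), rfl⟩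
      have hneg : (0 : ZMod p) - ((0 : ℕ) : ZMod p) ∈ (A i).image (fun x => (0 : ZMod p) - x) := mem_image.2 ⟨_, hk, rfl⟩
      have := Finset.add_mem_add hneg hy0
      convert this using 1
      rw [Nat.cast_sub (show a - 1 ≤ t by omega), Nat.cast_zero]; ring
  -- the pinned cover `SY`
  set syM := maskOf (List.range (a + L - 1)) with hsyM
  have htb_syM : ∀ v, tb syM v = true ↔ v < a + L - 1 := fun v => by rw [hsyM, tb_maskOf, List.mem_range]
  -- translates
  have htrans_mem : ∀ (r w : ℕ) (cc : ZMod p), cc.val = r → w ∈ patt →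
      ∃ x ∈ A i, ∃ b ∈ B i, ((((r + p - w) % p : ℕ)) : ZMod p) = cc - x - b := by
    intro r w cc hr hw
    obtain ⟨x, hx, b, hb, rfl⟩ := (hpatt_mem w).1 hw
    refine ⟨x, hA0mem x hx, b, hb, ?_⟩
    rw [cast_add_sub_mod (by have := Nat.mod_lt (x + b.val) hp0; omega), hpatt_cast, ← hr, ZMod.natCast_zmod_val]; ring
  set RS := (C i).image ZMod.val with hRS
  have hRSmem : ∀ r, r ∈ RS ↔ ∃ cc ∈ C i, cc.val = r := by
    intro r; rw [hRS, mem_image]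
  obtain ⟨hsub, hlen, hadm, hmemrs⟩ := admissible_filter_transMasks_all p patt syM RS
    (by
      intro r hr
      obtain ⟨cc, _, rfl⟩ := (hRSmem r).1 hr
      exact cc.val_lt)
    (by
      intro r hr w hw
      obtain ⟨cc, hcc, hr'⟩ := (hRSmem r).1 hr
      obtain ⟨x, hx, b, hb, hval⟩ := htrans_mem r w cc hr' hw
      have hinW : ((((r + p - w) % p : ℕ)) : ZMod p) ∈ W := by rw [hval]; exact hmemW x hx b hb cc hcc
      rw [Bool.eq_false_iff]
      intro htb
      have ht := (htb_syM _).1 htb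
      have hinSY := hmemSY _ ht
      exact Finset.disjoint_left.1 hWSY hinW hinSY)
    (by
      intro r hr r' hr' hne w hw w' hw' heq
      obtain ⟨cc, hcc, hrv⟩ := (hRSmem r).1 hr
      obtain ⟨cc', hcc', hrv'⟩ := (hRSmem r').1 hr'
      obtain ⟨x, hx, b, hb, hval⟩ := htrans_mem r w cc hrv hw
      obtain ⟨x', hx', b', hb', hval'⟩ := htrans_mem r' w' cc' hrv' hw'
      rw [heq, hval'] at hval
      obtain ⟨-, -, hccc⟩ := blockSum_inj hS i hx' hx hb' hb hcc' hcc hval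
      exact hne (by rw [← hrv, ← hrv', hccc]))
  have hlen' : ((transMasks p patt).filter fun x => decide (x.1 ∈ RS)).length = c := by
    rw [hlen, hRS, Finset.card_image_of_injective _ (ZMod.val_injective p), hc]
  set rs := (transMasks p patt).filter fun x => decide (x.1 ∈ RS) with hrs
  have hleaf := caseALeafT_of_caseADeadT h hpatt rs hsub hlen' hadm
  -- the cover `W ∪ SY`
  set cov := rs.foldl (fun cv x => cv ||| x.2) syM with hcov
  have hcov_mem : ∀ v, tb cov v = true → ∃ e ∈ W ∪ SY, e.val = v := by
    intro v hv
    rw [hcov, tb_foldl_lor] at hv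
    rcases hv with hv | ⟨x, hx, hv⟩
    · have ht := (htb_syM v).1 hv
      exact ⟨(v : ZMod p), mem_union_right _ (hmemSY v ht), ZMod.val_natCast_of_lt (by omega)⟩
    · obtain ⟨hx1, hxe⟩ := (hmemrs x).1 hx
      obtain ⟨cc, hcc, hrv⟩ := (hRSmem _).1 hx1
      rw [hxe] at hv
      obtain ⟨w, hw, hwv⟩ := (tb_transMask p patt x.1 _).1 hv
      obtain ⟨x', hx', b, hb, hval⟩ := htrans_mem x.1 w cc hrv hw
      refine ⟨cc - x' - b, mem_union_left _ (hmemW x' hx' b hb cc hcc), ?_⟩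
      rw [← hval, ZMod.val_natCast, Nat.mod_mod, hwv]
  have hcov_lt : cov < 2 ^ p := by
    refine Nat.lt_pow_two_of_testBit _ fun j hj => ?_
    rw [← tb_eq_testBit, Bool.eq_false_iff]
    intro htb
    obtain ⟨e, _, hev⟩ := hcov_mem j htb
    have := e.val_lt; omega
  have hM : fullMask p ^^^ cov < 2 ^ p := by
    rw [fullMask_eq]; exact Nat.xor_lt_two_pow (by have := Nat.one_le_two_pow (n := p); omega) hcov_lt
  -- `Z° ⊆` the candidate mask
  set zc := Q.foldl (fun m q => m &&& rot p (fullMask p ^^^ cov) q) (fullMask p) with hzc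
  have hZmem : ∀ ζ ∈ DU A C (univ.erase i), ζ.val ∈ members (List.range p) zc := by
    intro ζ hζ
    rw [mem_members, List.mem_range]
    refine ⟨ζ.val_lt, ?_⟩
    rw [hzc, tb_foldl_land_rot hM hQlt ζ.val_lt]
    intro q hq
    obtain ⟨b, hb, rfl⟩ := (hQmem q).1 hq
    have hlt : (ζ.val + p - b.val) % p < p := Nat.mod_lt _ hp0
    rw [tb_compl hlt, Bool.not_eq_true', Bool.eq_false_iff]
    intro htb
    obtain ⟨e, he, hev⟩ := hcov_mem _ htb
    have hecast : e = ζ - b := by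
      have := congrArg (fun n : ℕ => (n : ZMod p)) hev
      simp only [ZMod.natCast_zmod_val] at this
      rw [this, cast_add_sub_mod (by have := b.val_lt; omega), ZMod.natCast_zmod_val, ZMod.natCast_zmod_val]
    have hinT : ζ - b ∈ T := by
      have hneg : (0 : ZMod p) - b ∈ (B i).image (fun x => (0 : ZMod p) - x) := mem_image.2 ⟨b, hb, rfl⟩
      have := Finset.add_mem_add hneg hζ
      convert this using 1; ring
    rw [hecast] at he
    exact Finset.disjoint_left.1 hTWSY hinT he
  set Zo := (members (List.range p) zc).filter fun v => decide (v ∈ (DU A C (univ.erase i)).image ZMod.val) with hZo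
  have hZcard : #(DU A C (univ.erase i)) = z := by rw [card_DU_AC hS hB, hz]
  have hZomem : Zo ∈ (members (List.range p) zc).sublistsLen z := by
    rw [← hZcard, ← card_image_of_injective (DU A C (univ.erase i)) (ZMod.val_injective p)]
    exact filter_mem_sublistsLen _ (nodup_members List.nodup_range _) _ fun v hv => by
      obtain ⟨ζ, hζ, rfl⟩ := mem_image.1 hv
      exact hZmem ζ hζ
  have hZo_mem : ∀ v, v ∈ Zo ↔ ∃ ζ ∈ DU A C (univ.erase i), ζ.val = v := by
    intro v; rw [hZo, List.mem_filter, decide_eq_true_eq, mem_image]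
    constructor
    · exact fun h => h.2
    · rintro ⟨ζ, hζ, rfl⟩; exact ⟨hZmem ζ hζ, ζ, hζ, rfl⟩
  have hZo_nd : Zo.Nodup := (nodup_members List.nodup_range _).filter _
  -- the leaf puts `(Yo, Zo)` in the table
  have hmem := mem_of_caseALeafT hleaf Zo hZomem
  set Yo := (List.range L).map fun t => a - 1 + t with hYo
  have hYo_mem : ∀ v, v ∈ Yo ↔ ∃ e ∈ DU B C (univ.erase i), e.val = v := by
    intro v; rw [hYo, List.mem_map, hY]
    constructor
    · rintro ⟨t, ht, rfl⟩
      have htL := List.mem_range.1 ht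
      refine ⟨((a - 1 : ℕ) : ZMod p) + (t : ZMod p), mem_image.2 ⟨t, mem_range.2 htL, rfl⟩, ?_⟩
      rw [← Nat.cast_add, ZMod.val_natCast_of_lt (by omega)]
    · rintro ⟨e, he, rfl⟩
      obtain ⟨t, ht, rfl⟩ := mem_image.1 he
      have htL := mem_range.1 ht
      refine ⟨t, List.mem_range.2 htL, ?_⟩
      rw [← Nat.cast_add, ZMod.val_natCast_of_lt (by omega)]
  have hYo_nd : Yo.Nodup := by
    rw [hYo]
    exact (List.nodup_range (n := L)).map fun t t' htt => Nat.add_left_cancel htt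
  exact hdead _ hmem A B C hS hA hB hC ks hks hksi hszs hYo_nd hZo_nd hYo_mem hZo_mem

end Summit.MatrixMultiplication.OmegaCensus.CubeNB.S2
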